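import Summits.BirchSwinnertonDyer.BirchSwinnertonDyer.Theorems.UniversalToricDescentToricFrameExistsDefs
import HarnessLib
import HarnessLib.Audit.Tags

/-!
# Route `UniversalToricDescent` — light defs module for the research stub (E|L) `ToricFrameExistsOfBDPFrameAtThree`
# (existence of a ♯♯-frame GIVEN a non-zero ♯-frame of the anticyclotomic BDP function; crux r204 stmt-BirchSwinnertonDyer-24207
# `RationalSplitIMCInclusionAtThree`, line `ratwall_thin_comb`, skeleton v12)

Cell `pub/bsd-wall`, LEAD `cruxlead-24207` (g39), 2026-08-30; `--supports stmt-BirchSwinnertonDyer-24207 --as helper`.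
Companion of `UniversalToricDescentToricFrameExistsDefs` (g38, the v11 stub (E) `ToricFrameExistsAtThree`). WHY ANOTHER CONSTANT. The crux
`RationalSplitIMCInclusionAtThree` is a statement ABOUT a given integral one-variable frame: «for every `Ω_K, Ω_p ≠ 0` and every
`L ∈ R₀⟦T⟧` with `IsBDPLFunction ι′ 𝔭 κ γ f_E Ω_K Ω_p L`, `∃ k, 3^k·L ∈ Ch_Λ(X_ac)·R₀⟦T⟧`». Where no such `L` exists the crux holds
vacuously, and where `L = 0` it holds with `k = 0`. The v11 stub (E) asks for a two-variable ♯♯-frame UNCONDITIONALLY — so in a world in which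
the anticyclotomic `3`-adic `L`-function of `f_E` at the additive split `3` exists only as an UNBOUNDED rigid-analytic distribution (the shape in
which it IS in print: Liu–Zhang–Zhang 2018, «a p-adic Waldspurger formula», no condition on `π_𝔭`, `𝔭` split — an element of the distribution
algebra `𝒟(π)`, integrality not asserted) and no non-zero INTEGRAL frame exists in either one or two variables, the crux is TRUE (vacuously) while
(E) is FALSE and the line `ratwall_thin_comb` would be dead for a reason foreign to the crux. (A non-zero two-variable ♯♯-frame restricts on the
central ray to a non-zero one-variable ♯-frame up to constants: `…RatwallThinComb.ContRigidityUpTo`, `IsToricTwoVarLFunctionUpTo₂.hasValueAt₂_centralRay`;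
so «no integral one-variable frame» forces «no non-zero integral two-variable frame».) The composition of the line only ever USES the two-variable
frame at crux data that COME WITH a non-zero BDP frame `L` (certificate `…ClosedModuloV89`). Hence the honest residue of the line is the
CONDITIONAL existence below — (E) restricted to the crux's own hypothesis:

  (E|L) for the (E)-data `(W, N, K, Dt, κ′, γ, 𝔭, 𝔭′, ι′)` and every `Ω_K, Ω_p ≠ 0`, `L ≠ 0` with `IsBDPLFunction ι′ 𝔭 κ′ γ Dt.f Ω_K Ω_p L`,
  in every `𝔭`-adapted generator pair `(κ₁, κ₂; γ₁, γ₂; k)` of the `ℤ₃²`-tower there is a ♯♯-frame `L₂ ∈ R₀⟦T₁⟧⟦T₂⟧` with SOME constants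
  `(C, X, Y) ∈ (ℂ₃ˣ)³` (`IsToricTwoVarLFunctionUpTo₂`).

In words: EVERY NON-ZERO INTEGRAL ANTICYCLOTOMIC BDP FRAME OF `f_E` AT THE ADDITIVE SPLIT `3` SITS UNDER A TWO-VARIABLE INTEGRAL TORIC FRAME — the
existence half of Castella–Wan's Cor. 2.12 («`L_{𝔭,ac}(f/K)` is the restriction of `L_𝔭(f/K)` to the anticyclotomic line») read at `p = 3 ∣ N`.
MONOTONE: (E) ⟹ (E|L) trivially (`toricFrameExistsOfBDPFrame_of_toricFrameExists`), so skeleton v12's stub 1 is WEAKER than v11's; the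
difference is exactly the vacuity gap described above. Contains ONLY the `@[conjecture] def … : Prop` (an OPEN statement in our theories — human
rule 2026-08-15: tagged `@[conjecture]`, an obligation node provable / refutable BY NAME, never a Literature fact), an `Iff.rfl` readback and the
one-line monotonicity lemma. ROUTE-INDEPENDENT (no `Theses` import); no instance, no notation, no `sorry`. Declaring the constant proves nothing:
crux 24207 stays OPEN and BSD is proved for no curve by this file.

References: [Hida1988AIF] §5 Thm. 5.1b, Lemma 5.2 (ii) (standing p ≥ 5; shape of the two-variable interpolation); [CastellaWan2023] §2.4
Thm. 2.11, Cor. 2.12 (arXiv:1607.02019); [LiuZhangZhang2018] Thm. 1.8 / §1 p. 3 («neither the Heegner condition nor any control of ramification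
… only 𝔭 split»; Duke Math. J. 167, arXiv:1511.08172); [Castella2018] Thm. 3.1 (shape of the one-variable ♯-frame).
-/

noncomputable section

open scoped Classical NumberField

set_option linter.dupNamespace false -- `…BirchSwinnertonDyer.BirchSwinnertonDyer…` is the cell's nested layout (D-0017)
set_option autoImplicit false

namespace Summit.BirchSwinnertonDyer.BirchSwinnertonDyer.Theorems.UniversalToricDescentToricFrameExistsOfBDPDefs

open NumberField IsDedekindDomain Field
open Literature.NumberTheory.EllipticCurves

/-- **`ToricFrameExistsOfBDPFrameAtThree`** ((E|L) of line `ratwall_thin_comb` on crux 24207 — the stub `stub_toricFrameExistsOfBDP` of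
skeleton v12 = the v11 stub (E) `ToricFrameExistsAtThree` RESTRICTED TO THE CRUX'S OWN HYPOTHESIS, as a named `Prop`). For every class-O6,
`ρ̄₃`-onto, analytic-rank-one `E/ℚ` of conductor `N`, imaginary quadratic Heegner `K` (`3 = 𝔭𝔭′` split, `𝔭` of degree one), anticyclotomic
`κ′` with top generator `γ`, `ι′` inducing `𝔭`, and every NON-ZERO `L ∈ R₀⟦T⟧` with `IsBDPLFunction ι′ 𝔭 κ′ γ Dt.f Ω_K Ω_p L` (`Ω_K, Ω_p ≠ 0`)
— the datum the crux `RationalSplitIMCInclusionAtThree` quantifies over —, in every `𝔭`-adapted generator pair of the `ℤ₃²`-tower there is a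
♯♯-frame `L₂ ∈ R₀⟦T₁⟧⟦T₂⟧` of the toric two-variable `3`-adic `L`-function of `f_E` with SOME constants `(C, X, Y)`, `Ω_K′, C, X, Y ≠ 0`.
RESEARCH / ADAPTATION (Hida 1988 Thm. 5.1b ⊗ Castella–Wan 2.11 / 2.12 at `p = 3`; one-variable existence as a distribution: Liu–Zhang–Zhang
2018; integrality in print for no construction at an additive `3`); a definition only, nothing is proved by it.
[cite: Hida1988AIF, §5 Thm. 5.1b, Lemma 5.2 (ii) (shape of the interpolation; standing p ≥ 5; nothing asserted)]
[cite: CastellaWan2023, §2.4 Thm. 2.11, Cor. 2.12 (arXiv:1607.02019; the display and the restriction to the anticyclotomic line; nothing asserted)]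
[cite: LiuZhangZhang2018, Thm. 1.8 (arXiv:1511.08172; one-variable existence in 𝒟(π), 𝔭 split, any π_𝔭; nothing asserted here)] -/
@[conjecture]
def ToricFrameExistsOfBDPFrameAtThree : Prop :=
    ∀ (W : WeierstrassCurve ℚ) [W.IsElliptic] [W.IsGloballyMinimal] (N : ℕ) [NeZero N] (K : Type) [Field K]
      [NumberField K] (Dt : Literature.NumberTheory.EllipticCurves.ModularForms.ModularParametrizationData W N),
    Summit.BirchSwinnertonDyer.Rank1Residual.Additive.ClassO6 W 3 → W.HasSurjectiveModNGaloisRep 3 →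
    W.analyticRank = 1 → W.conductorNorm ℤ = N → IsImaginaryQuadratic K → SatisfiesHeegnerHypothesis N K →
    ∀ (κ' : ZpExtension K 3), κ'.IsAnticyclotomic → ∀ (γ : Field.absoluteGaloisGroup K) [Fact (κ'.IsTopGenerator γ)]
      (𝔭 : HeightOneSpectrum (𝓞 K)), ((3 : ℕ) : 𝓞 K) ∈ 𝔭.asIdeal →
      𝔭.asIdeal.ramificationIdx (𝓞 ℚ) = 1 → 𝔭.asIdeal.inertiaDeg (𝓞 ℚ) = 1 →
    ∀ (𝔭' : HeightOneSpectrum (𝓞 K)), ((3 : ℕ) : 𝓞 K) ∈ 𝔭'.asIdeal → 𝔭' ≠ 𝔭 →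
    ∀ (ι' : PadicAlgCl 3 ≃+* ℂ), Summit.BirchSwinnertonDyer.BirchSwinnertonDyer.Theorems.SchneiderFree.BranchInducesPrime 3 ι' 𝔭 →
    ∀ (ΩK : ℂ) (Ωp : ℂ_[3]) (L : UnrSeries 3), ΩK ≠ 0 → Ωp ≠ 0 → IsBDPLFunction ι' 𝔭 κ' γ Dt.f ΩK Ωp L → L ≠ 0 →
    ∀ (κ₁ κ₂ : ZpExtension K 3) (γ₁ γ₂ : Field.absoluteGaloisGroup K) (k : ℕ)
      [Fact (ZpExtension.IsTopGeneratorPair κ₁ κ₂ γ₁ γ₂)],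
    (∀ v : HeightOneSpectrum (𝓞 K), v ≠ 𝔭 → ∀ 𝔓 ∈ v.primesAbove,
        𝔓.inertia (Field.absoluteGaloisGroup K) ≤ κ₁.kerSubgroup) →
    ZpExtension.pairKer κ₁ κ₂ ≤ κ'.kerSubgroup → γ₁ * γ⁻¹ ∈ κ'.kerSubgroup → γ₂ * (γ ^ (3 ^ k))⁻¹ ∈ κ'.kerSubgroup →
    ∃ (ΩK' : ℂ) (C X Y : ℂ_[3]) (L₂ : PowerSeries (PowerSeries (unrIntegers 3))),
      ΩK' ≠ 0 ∧ C ≠ 0 ∧ X ≠ 0 ∧ Y ≠ 0 ∧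
      IsToricTwoVarLFunctionUpTo₂ C X Y ι' 𝔭 𝔭' κ₁ κ₂ γ₁ γ₂ Dt.f ΩK' L₂

/-- **Readback** (`Iff.rfl`): `ToricFrameExistsOfBDPFrameAtThree` unfolds to the (E|L) text literally (the hypothesis `hE'` of
`…ClosedModuloV89.RationalSplitIMCInclusionAtThree_of_existsOfBDP_of_jacquet_of_nekovar_of_ratCombDvd`).
[cite: CastellaWan2023, §2.4 Thm. 2.11, Cor. 2.12 (shape; nothing asserted)] -/
theorem toricFrameExistsOfBDPFrameAtThree_iff :
    ToricFrameExistsOfBDPFrameAtThree ↔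
    ∀ (W : WeierstrassCurve ℚ) [W.IsElliptic] [W.IsGloballyMinimal] (N : ℕ) [NeZero N] (K : Type) [Field K]
      [NumberField K] (Dt : Literature.NumberTheory.EllipticCurves.ModularForms.ModularParametrizationData W N),
    Summit.BirchSwinnertonDyer.Rank1Residual.Additive.ClassO6 W 3 → W.HasSurjectiveModNGaloisRep 3 →
    W.analyticRank = 1 → W.conductorNorm ℤ = N → IsImaginaryQuadratic K → SatisfiesHeegnerHypothesis N K →
    ∀ (κ' : ZpExtension K 3), κ'.IsAnticyclotomic → ∀ (γ : Field.absoluteGaloisGroup K) [Fact (κ'.IsTopGenerator γ)]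
      (𝔭 : HeightOneSpectrum (𝓞 K)), ((3 : ℕ) : 𝓞 K) ∈ 𝔭.asIdeal →
      𝔭.asIdeal.ramificationIdx (𝓞 ℚ) = 1 → 𝔭.asIdeal.inertiaDeg (𝓞 ℚ) = 1 →
    ∀ (𝔭' : HeightOneSpectrum (𝓞 K)), ((3 : ℕ) : 𝓞 K) ∈ 𝔭'.asIdeal → 𝔭' ≠ 𝔭 →
    ∀ (ι' : PadicAlgCl 3 ≃+* ℂ), Summit.BirchSwinnertonDyer.BirchSwinnertonDyer.Theorems.SchneiderFree.BranchInducesPrime 3 ι' 𝔭 →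
    ∀ (ΩK : ℂ) (Ωp : ℂ_[3]) (L : UnrSeries 3), ΩK ≠ 0 → Ωp ≠ 0 → IsBDPLFunction ι' 𝔭 κ' γ Dt.f ΩK Ωp L → L ≠ 0 →
    ∀ (κ₁ κ₂ : ZpExtension K 3) (γ₁ γ₂ : Field.absoluteGaloisGroup K) (k : ℕ)
      [Fact (ZpExtension.IsTopGeneratorPair κ₁ κ₂ γ₁ γ₂)],
    (∀ v : HeightOneSpectrum (𝓞 K), v ≠ 𝔭 → ∀ 𝔓 ∈ v.primesAbove,
        𝔓.inertia (Field.absoluteGaloisGroup K) ≤ κ₁.kerSubgroup) →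
    ZpExtension.pairKer κ₁ κ₂ ≤ κ'.kerSubgroup → γ₁ * γ⁻¹ ∈ κ'.kerSubgroup → γ₂ * (γ ^ (3 ^ k))⁻¹ ∈ κ'.kerSubgroup →
    ∃ (ΩK' : ℂ) (C X Y : ℂ_[3]) (L₂ : PowerSeries (PowerSeries (unrIntegers 3))),
      ΩK' ≠ 0 ∧ C ≠ 0 ∧ X ≠ 0 ∧ Y ≠ 0 ∧
      IsToricTwoVarLFunctionUpTo₂ C X Y ι' 𝔭 𝔭' κ₁ κ₂ γ₁ γ₂ Dt.f ΩK' L₂ :=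
  Iff.rfl

/-- **MONOTONICITY (E) ⟹ (E|L)**: the bare existence `ToricFrameExistsAtThree` (skeleton v11's stub 1) implies the conditional existence
`ToricFrameExistsOfBDPFrameAtThree` (skeleton v12's stub 1) — drop the BDP-frame hypotheses. So v12's first stub is WEAKER than v11's.
[cite: Hida1988AIF, §5 Thm. 5.1b (shape; nothing asserted)] -/
theorem toricFrameExistsOfBDPFrame_of_toricFrameExists
    (hE : Summit.BirchSwinnertonDyer.BirchSwinnertonDyer.Theorems.UniversalToricDescentToricFrameExistsDefs.ToricFrameExistsAtThree) :
    ToricFrameExistsOfBDPFrameAtThree := by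
  intro W _ _ N _ K _ _ Dt hO6 hsurj hrk hN hK hH κ' hκ' γ _ 𝔭 h3 hram hdeg 𝔭' h3' hne ι' hι _ _ _ _ _ _ _
    κ₁ κ₂ γ₁ γ₂ k _ hur₁ hker hγ₁ hγ₂
  exact hE W N K Dt hO6 hsurj hrk hN hK hH κ' hκ' γ 𝔭 h3 hram hdeg 𝔭' h3' hne ι' hι κ₁ κ₂ γ₁ γ₂ k hur₁ hker hγ₁ hγ₂

end Summit.BirchSwinnertonDyer.BirchSwinnertonDyer.Theorems.UniversalToricDescentToricFrameExistsOfBDPDefs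

end
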